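import Summits.QuantumFields.QCD.Theses.HeatSlicedQuarks
import Summits.QuantumFields.QCD.Theorems.HeatSlicedQuarksSmallFieldUltracontractivityBootHopping
import Summits.QuantumFields.QCD.Theorems.HeatSlicedQuarksSmallFieldUltracontractivityStubFreeKernelFourier
import Mathlib.Analysis.CStarAlgebra.Matrix

/-!
# Helpers (A) for stub `stub_firstOrderTracedPairing` of line `Sketch`
(crux `Summit.QuantumFields.QCD.Theses.HeatSlicedQuarks.TracedQuadraticParametrix`, item stmt-QuantumFields-17985)

The COLOUR-TRACE mechanism by which the first-order term of the heat-kernel Duhamel series becomes second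
order in the field amplitude:

* `norm_trace_sub_one_le` / registered form `stub_su3TraceInequality` — the `SU(3)` trace inequality
  `|tr (V − 1)| ≤ 6 (3 − Re tr V)` for a unitary `3 × 3` matrix of determinant one.  Proof: with `A = V − 1`,
  `det (1 + A) = 1 + tr A + e₂(A) + det A = 1` (`Matrix.det_fin_three`), so `tr A = −e₂(A) − det A` is a sum of
  quadratic and cubic monomials in the entries of `A` (all of modulus `≤ 2`), hence `≤ 3 Σ|A_{ab}|² =
  6 (3 − Re tr V)` (`sum_norm_sq_sub_one_eq` of `…SmallFieldUltracontractivityBootHopping`);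
  `norm_trace_link_sub_one_le`, `norm_trace_link_inv_sub_one_le` — the same for a link `W ∈ SU(3)` and its
  inverse (`ρ(W⁻¹) = (ρW)ᴴ`);
* `wilsonDirac_freeCfg_colour`, `freeKernel_colour`, `colour_mul` — the free Wilson–Dirac matrix `D₁`, the free
  heat kernel `K₁(σ) = e^{-σD₁ᴴD₁}` (torus-Fourier formula `stub_freeKernelFourier`) and their products have the
  trivial colour factor `δ_{ca}`: `M((y,c,β),(z,a,α)) = [c = a] M((y,0,β),(z,0,α))`;
* `sum_conjTranspose_mul_mul_apply_eq`, `norm_sum_conjTranspose_mul_mul_apply_le` — the colour trace formula: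
  if the columns of `A`, `B` at `x` have the trivial colour factor, then
  `Σ_a (Aᴴ X B)((x,a,α),(x,a,α)) = Σ conj(u) v · (Σ_a X((y,a,β),(y',a,β')))` only sees the colour traces of
  the site–spin blocks of `X`, with the corresponding norm bound.

Finite-dimensional linear algebra over Mathlib and the two cited tree files; no named facts are used.
-/

noncomputable section

namespace Summit.QuantumFields.QCD.Cruxes.TracedQuadraticParametrix.Sketch

open Literature.MathematicalPhysics.QuantumLattice Literature.MathematicalPhysics.QuantumFieldTheory
  Literature.Probability.LatticeModels
open Summit.QuantumFields.QCD.Theses.HeatSlicedQuarks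
open Summit.QuantumFields.QCD.Cruxes.SmallFieldUltracontractivity.PointCentredAxialParabolic
open Summit.QuantumFields.QCD.Theorems.SmallFieldUltracontractivity.Negative
open Summit.QuantumFields.QCD.Theorems.HeatSlicedQuarksDaviesGaffney
open scoped Matrix ComplexConjugate

/-! ### The `SU(3)` trace inequality -/

section SU3

variable {L : ℕ}

/-- The polynomial identity behind the trace inequality: for a `3 × 3` matrix `A` with `det (1 + A) = 1`,
`tr A = -e₂(A) - det A` written out in the entries. -/
theorem trace_eq_of_det_one_add_eq_one (A : Matrix (Fin 3) (Fin 3) ℂ) (h : (1 + A).det = 1) :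
    A.trace = -(A 0 0 * A 1 1 + A 0 0 * A 2 2 + A 1 1 * A 2 2 - A 1 2 * A 2 1 - A 0 1 * A 1 0 - A 0 2 * A 2 0)
      - (A 0 0 * A 1 1 * A 2 2 - A 0 0 * A 1 2 * A 2 1 - A 0 1 * A 1 0 * A 2 2 + A 0 1 * A 1 2 * A 2 0
        + A 0 2 * A 1 0 * A 2 1 - A 0 2 * A 1 1 * A 2 0) := by
  rw [Matrix.det_fin_three] at h
  simp only [Matrix.add_apply, Matrix.one_apply_eq, Matrix.one_apply_ne (by decide : (0 : Fin 3) ≠ 1),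
    Matrix.one_apply_ne (by decide : (0 : Fin 3) ≠ 2), Matrix.one_apply_ne (by decide : (1 : Fin 3) ≠ 0),
    Matrix.one_apply_ne (by decide : (1 : Fin 3) ≠ 2), Matrix.one_apply_ne (by decide : (2 : Fin 3) ≠ 0),
    Matrix.one_apply_ne (by decide : (2 : Fin 3) ≠ 1), zero_add] at h
  rw [Matrix.trace_fin_three]
  linear_combination h

/-- An elementary real inequality: for nine numbers in `[0, 2]`, the sum of the six quadratic and six cubic
monomial moduli of `e₂` and `det` is at most three times the sum of squares. -/
theorem e2_det_monomials_le (a b c d e f g h i : ℝ) (hd : 0 ≤ d)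
    (he : 0 ≤ e) (hf : 0 ≤ f) (hg : 0 ≤ g) (hh : 0 ≤ h) (hi : 0 ≤ i) (ha2 : a ≤ 2) (hb2 : b ≤ 2)
    (hc2 : c ≤ 2) :
    (a * e + a * i + e * i + f * h + b * d + c * g) +
      (a * e * i + a * f * h + b * d * i + b * f * g + c * d * h + c * e * g) ≤
      3 * (a ^ 2 + b ^ 2 + c ^ 2 + d ^ 2 + e ^ 2 + f ^ 2 + g ^ 2 + h ^ 2 + i ^ 2) := by
  have q1 : 2 * a * e ≤ a ^ 2 + e ^ 2 := two_mul_le_add_sq a e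
  have q2 : 2 * a * i ≤ a ^ 2 + i ^ 2 := two_mul_le_add_sq a i
  have q3 : 2 * e * i ≤ e ^ 2 + i ^ 2 := two_mul_le_add_sq e i
  have q4 : 2 * f * h ≤ f ^ 2 + h ^ 2 := two_mul_le_add_sq f h
  have q5 : 2 * b * d ≤ b ^ 2 + d ^ 2 := two_mul_le_add_sq b d
  have q6 : 2 * c * g ≤ c ^ 2 + g ^ 2 := two_mul_le_add_sq c g
  have c1 : a * e * i ≤ e ^ 2 + i ^ 2 := by
    nlinarith [mul_nonneg (sub_nonneg.2 ha2) (mul_nonneg he hi), two_mul_le_add_sq e i]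
  have c2 : a * f * h ≤ f ^ 2 + h ^ 2 := by
    nlinarith [mul_nonneg (sub_nonneg.2 ha2) (mul_nonneg hf hh), two_mul_le_add_sq f h]
  have c3 : b * d * i ≤ d ^ 2 + i ^ 2 := by
    nlinarith [mul_nonneg (sub_nonneg.2 hb2) (mul_nonneg hd hi), two_mul_le_add_sq d i]
  have c4 : b * f * g ≤ f ^ 2 + g ^ 2 := by
    nlinarith [mul_nonneg (sub_nonneg.2 hb2) (mul_nonneg hf hg), two_mul_le_add_sq f g]
  have c5 : c * d * h ≤ d ^ 2 + h ^ 2 := by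
    nlinarith [mul_nonneg (sub_nonneg.2 hc2) (mul_nonneg hd hh), two_mul_le_add_sq d h]
  have c6 : c * e * g ≤ e ^ 2 + g ^ 2 := by
    nlinarith [mul_nonneg (sub_nonneg.2 hc2) (mul_nonneg he hg), two_mul_le_add_sq e g]
  nlinarith [sq_nonneg a, sq_nonneg b, sq_nonneg c, sq_nonneg d, sq_nonneg e, sq_nonneg f, sq_nonneg g,
    sq_nonneg h, sq_nonneg i]

/-- **The `SU(3)` trace inequality**: for a unitary `3 × 3` matrix `V` of determinant one,
`|tr (V − 1)| ≤ 6 (3 − Re tr V)`.  From `det (1 + A) = 1 + tr A + e₂(A) + det A = 1` for `A = V − 1`: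
`tr A = −e₂(A) − det A` is at least quadratic in the entries of `A` (all of modulus `≤ 2`), and
`Σ |A_{ab}|² = 2 (3 − Re tr V)` (`sum_norm_sq_sub_one_eq`). -/
theorem norm_trace_sub_one_le (V : Matrix (Fin 3) (Fin 3) ℂ) (hV : V ∈ Matrix.unitaryGroup (Fin 3) ℂ)
    (hdet : V.det = 1) : ‖(V - 1).trace‖ ≤ 6 * (3 - V.trace.re) := by
  set A : Matrix (Fin 3) (Fin 3) ℂ := V - 1 with hA
  have hVA : V = 1 + A := by rw [hA, add_sub_cancel]
  have hdet' : (1 + A).det = 1 := by rw [← hVA]; exact hdet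
  have hF : ∑ a, ∑ b, ‖A a b‖ ^ 2 = 2 * (3 - V.trace.re) := sum_norm_sq_sub_one_eq V hV
  have hent : ∀ a b, ‖A a b‖ ≤ 2 := by
    intro a b
    rw [hA, Matrix.sub_apply]
    refine (norm_sub_le _ _).trans ?_
    have h1 : ‖V a b‖ ≤ 1 := entry_norm_bound_of_unitary hV a b
    have h2 : ‖(1 : Matrix (Fin 3) (Fin 3) ℂ) a b‖ ≤ 1 := by
      rw [Matrix.one_apply]; split_ifs <;> simp
    linarith
  have htr := trace_eq_of_det_one_add_eq_one A hdet'
  have hn3 : ∀ x y z : ℂ, ‖x * y * z‖ ≤ ‖x‖ * ‖y‖ * ‖z‖ := fun x y z => by rw [norm_mul, norm_mul]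
  have hn2 : ∀ x y : ℂ, ‖x * y‖ ≤ ‖x‖ * ‖y‖ := fun x y => (norm_mul x y).le
  have hQ : ‖A 0 0 * A 1 1 + A 0 0 * A 2 2 + A 1 1 * A 2 2 - A 1 2 * A 2 1 - A 0 1 * A 1 0 - A 0 2 * A 2 0‖ ≤
      ‖A 0 0‖ * ‖A 1 1‖ + ‖A 0 0‖ * ‖A 2 2‖ + ‖A 1 1‖ * ‖A 2 2‖ + ‖A 1 2‖ * ‖A 2 1‖ + ‖A 0 1‖ * ‖A 1 0‖ +
        ‖A 0 2‖ * ‖A 2 0‖ :=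
    norm_sub_le_of_le (norm_sub_le_of_le (norm_sub_le_of_le (norm_add_le_of_le (norm_add_le_of_le
      (hn2 _ _) (hn2 _ _)) (hn2 _ _)) (hn2 _ _)) (hn2 _ _)) (hn2 _ _)
  have hK : ‖A 0 0 * A 1 1 * A 2 2 - A 0 0 * A 1 2 * A 2 1 - A 0 1 * A 1 0 * A 2 2 + A 0 1 * A 1 2 * A 2 0
        + A 0 2 * A 1 0 * A 2 1 - A 0 2 * A 1 1 * A 2 0‖ ≤
      ‖A 0 0‖ * ‖A 1 1‖ * ‖A 2 2‖ + ‖A 0 0‖ * ‖A 1 2‖ * ‖A 2 1‖ + ‖A 0 1‖ * ‖A 1 0‖ * ‖A 2 2‖ +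
        ‖A 0 1‖ * ‖A 1 2‖ * ‖A 2 0‖ + ‖A 0 2‖ * ‖A 1 0‖ * ‖A 2 1‖ + ‖A 0 2‖ * ‖A 1 1‖ * ‖A 2 0‖ :=
    norm_sub_le_of_le (norm_add_le_of_le (norm_add_le_of_le (norm_sub_le_of_le (norm_sub_le_of_le
      (hn3 _ _ _) (hn3 _ _ _)) (hn3 _ _ _)) (hn3 _ _ _)) (hn3 _ _ _)) (hn3 _ _ _)
  have hreal := e2_det_monomials_le ‖A 0 0‖ ‖A 0 1‖ ‖A 0 2‖ ‖A 1 0‖ ‖A 1 1‖ ‖A 1 2‖ ‖A 2 0‖ ‖A 2 1‖ ‖A 2 2‖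
    (norm_nonneg _) (norm_nonneg _) (norm_nonneg _) (norm_nonneg _) (norm_nonneg _) (norm_nonneg _)
    (hent 0 0) (hent 0 1) (hent 0 2)
  simp only [Fin.sum_univ_three] at hF
  rw [htr]
  refine (norm_sub_le _ _).trans ?_
  rw [norm_neg]
  linarith

/-- **Registered form (stub `stub_su3TraceInequality` of the crux item)**: the `SU(3)` trace inequality
`|tr (V − 1)| ≤ 6 (3 − Re tr V)` for every unitary `3 × 3` complex matrix `V` with `det V = 1`. -/
theorem stub_su3TraceInequality :
    ∀ (V : Matrix (Fin 3) (Fin 3) ℂ), V ∈ Matrix.unitaryGroup (Fin 3) ℂ → V.det = 1 →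
      ‖(V - 1).trace‖ ≤ 6 * (3 - V.trace.re) :=
  fun V hV hdet => norm_trace_sub_one_le V hV hdet

end SU3

/-! ### Colour structure of the free operators and the colour trace formula -/

section Colour

variable {L : ℕ}

/-- **Colour structure of the free Wilson–Dirac matrix**: with all links `= 1` the colour factor of every
entry is `δ_{ca}`, so `D₁((y,c,β),(z,a,α)) = [c = a] · D₁((y,0,β),(z,0,α))`. -/
theorem wilsonDirac_freeCfg_colour (m : ℝ) (y : TorusSite 4 L) (c : Fin 3) (β : Fin 4)
    (z : TorusSite 4 L) (a : Fin 3) (α : Fin 4) :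
    wilsonDirac (fundamentalRep (Fin 3)) (freeCfg L) m 1 (y, c, β) (z, a, α) =
      if c = a then wilsonDirac (fundamentalRep (Fin 3)) (freeCfg L) m 1 (y, 0, β) (z, 0, α) else 0 := by
  simp only [wilsonDirac, Matrix.of_apply, freeCfg, map_one, inv_one, Matrix.one_apply, Prod.mk.injEq]
  by_cases h : c = a
  · subst h
    simp
  · simp [h]

/-- **Colour structure of the free heat kernel** (from the torus-Fourier formula `stub_freeKernelFourier`,
which is colour–spin diagonal with a colour–spin independent scalar kernel):
`K₁(σ)((y,c,β),(z,a,α)) = [c = a] · K₁(σ)((y,0,β),(z,0,α))`. -/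
theorem freeKernel_colour [NeZero L] (m σ : ℝ) (y : TorusSite 4 L) (c : Fin 3) (β : Fin 4)
    (z : TorusSite 4 L) (a : Fin 3) (α : Fin 4) :
    (NormedSpace.exp (-(σ : ℂ) •
        ((wilsonDirac (fundamentalRep (Fin 3)) (freeCfg L) m 1)ᴴ *
          wilsonDirac (fundamentalRep (Fin 3)) (freeCfg L) m 1))) (y, c, β) (z, a, α) =
      if c = a then (NormedSpace.exp (-(σ : ℂ) •
        ((wilsonDirac (fundamentalRep (Fin 3)) (freeCfg L) m 1)ᴴ *
          wilsonDirac (fundamentalRep (Fin 3)) (freeCfg L) m 1))) (y, 0, β) (z, 0, α) else 0 := by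
  rw [stub_freeKernelFourier L m σ y z c a β α, stub_freeKernelFourier L m σ y z 0 0 β α]
  by_cases h : c = a
  · subst h
    by_cases hβ : β = α
    · subst hβ; simp
    · simp [hβ]
  · have h1 : (c, β) ≠ (a, α) := fun e => h (Prod.mk.injEq _ _ _ _ ▸ e).1
    rw [if_neg h1, if_neg h]

variable [NeZero L]

/-- **Colour structure is preserved by products**: if `P` and `Q` both have colour factor `δ` (in the sense
`M((y,c,β),(z,a,α)) = [c = a] M((y,0,β),(z,0,α))`), then so does `P * Q`. -/
theorem colour_mul (P Q : Matrix (TorusSite 4 L × Fin 3 × Fin 4) (TorusSite 4 L × Fin 3 × Fin 4) ℂ)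
    (hP : ∀ (y : TorusSite 4 L) (c : Fin 3) (β : Fin 4) (z : TorusSite 4 L) (a : Fin 3) (α : Fin 4),
      P (y, c, β) (z, a, α) = if c = a then P (y, 0, β) (z, 0, α) else 0)
    (hQ : ∀ (y : TorusSite 4 L) (c : Fin 3) (β : Fin 4) (z : TorusSite 4 L) (a : Fin 3) (α : Fin 4),
      Q (y, c, β) (z, a, α) = if c = a then Q (y, 0, β) (z, 0, α) else 0)
    (y : TorusSite 4 L) (c : Fin 3) (β : Fin 4) (z : TorusSite 4 L) (a : Fin 3) (α : Fin 4) :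
    (P * Q) (y, c, β) (z, a, α) = if c = a then (P * Q) (y, 0, β) (z, 0, α) else 0 := by
  -- both sides reduce to `[c = a] Σ_w Σ_γ P((y,0,β),(w,0,γ)) Q((w,0,γ),(z,0,α))`
  have key : ∀ c' a' : Fin 3, (P * Q) (y, c', β) (z, a', α) =
      if c' = a' then ∑ w : TorusSite 4 L, ∑ γ : Fin 4, P (y, 0, β) (w, 0, γ) * Q (w, 0, γ) (z, 0, α)
      else 0 := by
    intro c' a'
    rw [Matrix.mul_apply, Fintype.sum_prod_type]
    have hin : ∀ w : TorusSite 4 L, ∑ eγ : Fin 3 × Fin 4, P (y, c', β) (w, eγ) * Q (w, eγ) (z, a', α) =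
        if c' = a' then ∑ γ : Fin 4, P (y, 0, β) (w, 0, γ) * Q (w, 0, γ) (z, 0, α) else 0 := by
      intro w
      rw [Fintype.sum_prod_type, Finset.sum_comm]
      have hterm : ∀ (γ : Fin 4) (e : Fin 3), P (y, c', β) (w, e, γ) * Q (w, e, γ) (z, a', α) =
          if c' = e then (if e = a' then P (y, 0, β) (w, 0, γ) * Q (w, 0, γ) (z, 0, α) else 0) else 0 := by
        intro γ e
        rw [hP y c' β w e γ, hQ w e γ z a' α]
        split_ifs <;> simp
      simp_rw [hterm, Finset.sum_ite_eq, Finset.mem_univ, if_true]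
      split_ifs <;> simp
    simp_rw [hin]
    split_ifs <;> simp
  rw [key c a, key 0 0, if_pos rfl]

/-- **The colour trace formula.**  If the columns of `A` and `B` through the fibre at `x` (spin `α`) have
colour factor `δ` — `A((y,c,β),(x,a,α)) = [c = a] u(y,β)`, `B((y,c,β),(x,a,α)) = [c = a] v(y,β)` — then
the colour sum of the diagonal entries of `Aᴴ X B` only sees the COLOUR TRACES of the blocks of `X`:
`Σ_a (Aᴴ X B)((x,a,α),(x,a,α)) = Σ_{y',β'} Σ_{y,β} conj(u(y,β)) v(y',β') Σ_a X((y,a,β),(y',a,β'))`. -/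
theorem sum_conjTranspose_mul_mul_apply_eq
    (A X B : Matrix (TorusSite 4 L × Fin 3 × Fin 4) (TorusSite 4 L × Fin 3 × Fin 4) ℂ)
    (x : TorusSite 4 L) (α : Fin 4) (u v : TorusSite 4 L → Fin 4 → ℂ)
    (hA : ∀ (y : TorusSite 4 L) (c : Fin 3) (β : Fin 4) (a : Fin 3),
      A (y, c, β) (x, a, α) = if c = a then u y β else 0)
    (hB : ∀ (y : TorusSite 4 L) (c : Fin 3) (β : Fin 4) (a : Fin 3),
      B (y, c, β) (x, a, α) = if c = a then v y β else 0) :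
    ∑ a : Fin 3, (Aᴴ * X * B) (x, a, α) (x, a, α) =
      ∑ y' : TorusSite 4 L, ∑ β' : Fin 4, ∑ y : TorusSite 4 L, ∑ β : Fin 4,
        star (u y β) * v y' β' * ∑ a : Fin 3, X (y, a, β) (y', a, β') := by
  -- expand the triple product entrywise and collapse the two colour sums
  have hexp : ∀ a : Fin 3, (Aᴴ * X * B) (x, a, α) (x, a, α) =
      ∑ y' : TorusSite 4 L, ∑ β' : Fin 4, ∑ y : TorusSite 4 L, ∑ β : Fin 4,
        star (u y β) * v y' β' * X (y, a, β) (y', a, β') := by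
    intro a
    rw [Matrix.mul_apply, Fintype.sum_prod_type]
    refine Finset.sum_congr rfl fun y' _ => ?_
    rw [Fintype.sum_prod_type, Finset.sum_comm]
    -- goal: Σ_{β'} Σ_{c'} (AᴴX)(p,(y',c',β')) B((y',c',β'),p) = Σ_{β'} Σ_y Σ_β ...
    refine Finset.sum_congr rfl fun β' _ => ?_
    have hB' : ∀ c' : Fin 3, (Aᴴ * X) (x, a, α) (y', c', β') * B (y', c', β') (x, a, α) =
        if c' = a then (Aᴴ * X) (x, a, α) (y', a, β') * v y' β' else 0 := by
      intro c'
      rw [hB y' c' β' a]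
      split_ifs with h
      · subst h; rfl
      · rw [mul_zero]
    simp_rw [hB', Finset.sum_ite_eq', Finset.mem_univ, if_true]
    -- now expand `(Aᴴ X)(p,(y',a,β'))`
    rw [Matrix.mul_apply, Fintype.sum_prod_type, Finset.sum_mul]
    refine Finset.sum_congr rfl fun y _ => ?_
    rw [Fintype.sum_prod_type, Finset.sum_comm, Finset.sum_mul]
    refine Finset.sum_congr rfl fun β _ => ?_
    have hA' : ∀ c : Fin 3, (Aᴴ) (x, a, α) (y, c, β) * X (y, c, β) (y', a, β') =
        if c = a then star (u y β) * X (y, a, β) (y', a, β') else 0 := by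
      intro c
      rw [Matrix.conjTranspose_apply, hA y c β a]
      split_ifs with h
      · subst h; rfl
      · rw [star_zero, zero_mul]
    simp_rw [hA', Finset.sum_ite_eq', Finset.mem_univ, if_true]
    ring
  simp_rw [hexp]
  -- move the colour sum inside
  rw [Finset.sum_comm]
  refine Finset.sum_congr rfl fun y' _ => ?_
  rw [Finset.sum_comm]
  refine Finset.sum_congr rfl fun β' _ => ?_
  rw [Finset.sum_comm]
  refine Finset.sum_congr rfl fun y _ => ?_
  rw [Finset.sum_comm]
  refine Finset.sum_congr rfl fun β _ => ?_
  rw [Finset.mul_sum]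

/-- **Norm form of the colour trace formula**: with entry profiles `|u(y,β)| ≤ f(y)`, `|v(y,β)| ≤ g(y)` and a
bound `h(y,y')` on the colour traces `|Σ_a X((y,a,β),(y',a,β'))|`,
`|Σ_a (Aᴴ X B)((x,a,α),(x,a,α))| ≤ 16 Σ_{y'} Σ_y f(y) g(y') h(y,y')`. -/
theorem norm_sum_conjTranspose_mul_mul_apply_le
    (A X B : Matrix (TorusSite 4 L × Fin 3 × Fin 4) (TorusSite 4 L × Fin 3 × Fin 4) ℂ)
    (x : TorusSite 4 L) (α : Fin 4) (u v : TorusSite 4 L → Fin 4 → ℂ) (f g : TorusSite 4 L → ℝ)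
    (h : TorusSite 4 L → TorusSite 4 L → ℝ)
    (hA : ∀ (y : TorusSite 4 L) (c : Fin 3) (β : Fin 4) (a : Fin 3),
      A (y, c, β) (x, a, α) = if c = a then u y β else 0)
    (hB : ∀ (y : TorusSite 4 L) (c : Fin 3) (β : Fin 4) (a : Fin 3),
      B (y, c, β) (x, a, α) = if c = a then v y β else 0)
    (hu : ∀ y β, ‖u y β‖ ≤ f y) (hv : ∀ y β, ‖v y β‖ ≤ g y)
    (hX : ∀ y β y' β', ‖∑ a : Fin 3, X (y, a, β) (y', a, β')‖ ≤ h y y') :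
    ‖∑ a : Fin 3, (Aᴴ * X * B) (x, a, α) (x, a, α)‖ ≤
      16 * ∑ y' : TorusSite 4 L, ∑ y : TorusSite 4 L, f y * g y' * h y y' := by
  rw [sum_conjTranspose_mul_mul_apply_eq A X B x α u v hA hB, Finset.mul_sum]
  refine (norm_sum_le _ _).trans (Finset.sum_le_sum fun y' _ => ?_)
  have hf0 : ∀ y, 0 ≤ f y := fun y => (norm_nonneg _).trans (hu y 0)
  have hg0 : ∀ y, 0 ≤ g y := fun y => (norm_nonneg _).trans (hv y 0)
  calc ‖∑ β' : Fin 4, ∑ y : TorusSite 4 L, ∑ β : Fin 4,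
          star (u y β) * v y' β' * ∑ a : Fin 3, X (y, a, β) (y', a, β')‖
      ≤ ∑ β' : Fin 4, ∑ y : TorusSite 4 L, ∑ β : Fin 4,
          ‖star (u y β) * v y' β' * ∑ a : Fin 3, X (y, a, β) (y', a, β')‖ := by
        refine (norm_sum_le _ _).trans (Finset.sum_le_sum fun β' _ => ?_)
        exact (norm_sum_le _ _).trans (Finset.sum_le_sum fun y _ => norm_sum_le _ _)
    _ ≤ ∑ _β' : Fin 4, ∑ y : TorusSite 4 L, ∑ _β : Fin 4, f y * g y' * h y y' := by
        refine Finset.sum_le_sum fun β' _ => Finset.sum_le_sum fun y _ => Finset.sum_le_sum fun β _ => ?_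
        rw [norm_mul, norm_mul, norm_star]
        have hh0 : 0 ≤ h y y' := (norm_nonneg _).trans (hX y β y' β')
        exact mul_le_mul (mul_le_mul (hu y β) (hv y' β') (norm_nonneg _) (hf0 y)) (hX y β y' β')
          (norm_nonneg _) (mul_nonneg (hf0 y) (hg0 y'))
    _ = 16 * ∑ y : TorusSite 4 L, f y * g y' * h y y' := by
        simp only [Finset.sum_const, Finset.card_univ, Fintype.card_fin, nsmul_eq_mul, Finset.mul_sum]
        push_cast
        refine Finset.sum_congr rfl fun y _ => ?_
        ring

end Colour

end Summit.QuantumFields.QCD.Cruxes.TracedQuadraticParametrix.Sketch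

end
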